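import Summits.BirchSwinnertonDyer.BirchSwinnertonDyer.Theses.GenusKolyvaginAtTwo
import Summits.BirchSwinnertonDyer.BirchSwinnertonDyer.Theorems.CMKolyvaginAtInertTwoConjugationTypeAtTwo
import Literature.NumberTheory.EllipticCurves.PointDivisibilityProofs
import Literature.NumberTheory.EllipticCurves.TorsionStructureProofs
import HarnessLib

/-!
# Route `GenusKolyvaginAtTwo`, support item Q1 `CyclicTorsionOfNegDisc` (stmt-BirchSwinnertonDyer-24879): PROVED

Prover seat bsd-line-gk2-p4 (g2, WIDTH-5 attach), cell `bsd-f1-sign2`, 2026-08-28. Item Q1 of the split of crux #3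
`KolyvaginExactAtTwo` (route rev 6): on the habitat `Δ(E) < 0`, for a complex conjugation `c₀ ∈ Gal(ℚ̄/ℚ)` and every `M`,
the geometric torsion `E[2^M]` is CYCLIC over `ℤ[c₀]` — some `P ∈ E[2^M]` has `E[2^M] = ℤ·P + ℤ·c₀P` (equivalently
`E[2^M] ≅ ℤ/2^M[Gal(K/ℚ)]` free of rank one; the structural input that replaces the `±`-eigenspace decomposition at `2`).
UNCONDITIONAL (tree theorems only); it closes the item BY NAME (`cyclicTorsionOfNegDisc_proof`). BSD is not proved by this;
the parent crux #3 and the summit are untouched.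

## Proof (elementary; no Nakayama, no matrices)

* `Δ < 0` ⟹ `c₀` moves a `2`-torsion point: `v ∈ E[2]` with `c₀v ≠ v` (CM sibling's
  `KolyvaginEigenTwo.exists_twoTorsion_smul_ne_of_Δ_neg`, from the sign of the discriminant of the `2`-division cubic). Then
  `0, v, c₀v, v + c₀v` are pairwise distinct, so `a·v + b·c₀v = 0 ⟹ 2 ∣ a, b`.
* INDEPENDENCE by induction on `k`: if `2^k P = v` then `a·P + b·c₀P = 0 ⟹ 2^{k+1} ∣ a, b` (multiply by `2^k` to get
  `2 ∣ a, b`, then apply the induction hypothesis to `2P`).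
* LIFT: `E(ℚ̄)` is `2^k`-divisible (`zsmul_geomPoints_surjective_holds`, Silverman AEC III.4.2(a)), so some `P` has `2^k P = v`,
  and `P ∈ E[2^{k+1}]`.
* COUNT: `(a, b) ↦ a·P + b·c₀P` is injective on `(ℤ/2^{k+1})²` by independence and `#E[2^{k+1}] = 4^{k+1}`
  (`card_torsionPoints_eq_sq_holds`, AEC III.6.4(b)), hence onto: every `Q ∈ E[2^{k+1}]` is `a·P + b·c₀P`.

References: [SilvermanAEC2009] III.4.2(a), III.6.4(b); [GrossLMS1991] §4 (complex conjugation on `E[p]`); [McCallumLMS1991] §5.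
-/

set_option linter.dupNamespace false -- tree convention: `Summit.BirchSwinnertonDyer.BirchSwinnertonDyer.Theorems` (summit = sub-problem)
set_option autoImplicit false
noncomputable section

open scoped Classical

namespace Summit.BirchSwinnertonDyer.BirchSwinnertonDyer.Theorems.GenusCyclicTorsion

open WeierstrassCurve Field Literature.NumberTheory.EllipticCurves Literature.NumberTheory.GaloisRepresentations

variable {W : WeierstrassCurve ℚ}

/-- `σ` commutes with integer multiples on `E(ℚ̄)` (the Galois action is by group automorphisms). [folklore] -/
theorem smul_zsmul_geomPoints (σ : absoluteGaloisGroup ℚ) (n : ℤ) (P : geomPoints W) : σ • (n • P) = n • (σ • P) :=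
  map_zsmul (DistribSMul.toAddMonoidHom (geomPoints W) σ) n P

/-- **The `2`-torsion relation.** If `2v = 0` and `c₀v ≠ v`, then `a·v + b·c₀v = 0` forces `a` and `b` even: the four points
`0, v, c₀v, v + c₀v` are pairwise distinct. [cite: GrossLMS1991, §4 (action of complex conjugation on E[p])] -/
theorem two_dvd_of_rel_twoTorsion (c₀ : absoluteGaloisGroup ℚ) {v : geomPoints W} (hv2 : (2 : ℤ) • v = 0)
    (hcv : c₀ • v ≠ v) {a b : ℤ} (hrel : a • v + b • (c₀ • v) = 0) : (2 : ℤ) ∣ a ∧ (2 : ℤ) ∣ b := by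
  have hv0 : v ≠ 0 := by
    rintro rfl
    exact hcv (smul_zero c₀)
  have hcv0 : c₀ • v ≠ 0 := fun h ↦ hv0 ((smul_eq_zero_iff_eq c₀).mp h)
  have hneg : -v = v := by
    rw [neg_eq_iff_add_eq_zero, ← two_zsmul]
    exact hv2
  have hc2 : (2 : ℤ) • (c₀ • v) = 0 := by rw [← smul_zsmul_geomPoints, hv2, smul_zero]
  -- reduce `a`, `b` mod `2`
  have hred : ∀ {w : geomPoints W}, (2 : ℤ) • w = 0 → ∀ n : ℤ, n • w = (n % 2) • w := by
    intro w hw n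
    conv_lhs => rw [← Int.mul_ediv_add_emod n 2]
    rw [add_zsmul, mul_zsmul', hw, zsmul_zero, zero_add]
  rw [hred hv2 a, hred hc2 b] at hrel
  rcases Int.emod_two_eq_zero_or_one a with ha | ha <;> rcases Int.emod_two_eq_zero_or_one b with hb | hb
  · exact ⟨Int.dvd_of_emod_eq_zero ha, Int.dvd_of_emod_eq_zero hb⟩
  · exfalso
    rw [ha, hb, zero_zsmul, one_zsmul, zero_add] at hrel
    exact hcv0 hrel
  · exfalso
    rw [ha, hb, one_zsmul, zero_zsmul, add_zero] at hrel
    exact hv0 hrel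
  · exfalso
    rw [ha, hb, one_zsmul, one_zsmul, add_comm, add_eq_zero_iff_eq_neg, hneg] at hrel
    exact hcv hrel

/-- **INDEPENDENCE.** If `2v = 0`, `c₀v ≠ v` and `2^k·P = v`, then `a·P + b·c₀P = 0 ⟹ 2^{k+1} ∣ a` and `2^{k+1} ∣ b`
(induction on `k`: multiply by `2^k` to see `a, b` even, then apply the case `k − 1` to `2P`). [cite: McCallumLMS1991, §5 (structure of E[p^M] under complex conjugation)] -/
theorem pow_dvd_of_rel (c₀ : absoluteGaloisGroup ℚ) {v : geomPoints W} (hv2 : (2 : ℤ) • v = 0) (hcv : c₀ • v ≠ v) :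
    ∀ (k : ℕ) (P : geomPoints W), ((2 ^ k : ℕ) : ℤ) • P = v →
      ∀ a b : ℤ, a • P + b • (c₀ • P) = 0 → ((2 ^ (k + 1) : ℕ) : ℤ) ∣ a ∧ ((2 ^ (k + 1) : ℕ) : ℤ) ∣ b := by
  intro k
  induction k with
  | zero =>
    intro P hP a b hrel
    rw [pow_zero, Nat.cast_one, one_zsmul] at hP
    subst hP
    simpa using two_dvd_of_rel_twoTorsion c₀ hv2 hcv hrel
  | succ k ih =>
    intro P hP a b hrel
    -- multiply the relation by `2^(k+1)`: `a·v + b·c₀v = 0`, so `a`, `b` are even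
    have hrel2 : a • v + b • (c₀ • v) = 0 := by
      have h := congrArg (fun Q : geomPoints W ↦ ((2 ^ (k + 1) : ℕ) : ℤ) • Q) hrel
      simp only [zsmul_add, smul_zero] at h
      rwa [← mul_zsmul, mul_comm, mul_zsmul, hP, ← mul_zsmul, mul_comm, mul_zsmul, ← smul_zsmul_geomPoints, hP] at h
    obtain ⟨⟨a₁, rfl⟩, ⟨b₁, rfl⟩⟩ := two_dvd_of_rel_twoTorsion c₀ hv2 hcv hrel2
    -- the relation for `2P`, which has `2^k · (2P) = v`
    have hP₁ : ((2 ^ k : ℕ) : ℤ) • ((2 : ℤ) • P) = v := by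
      have hc : ((2 ^ k : ℕ) : ℤ) * 2 = ((2 ^ (k + 1) : ℕ) : ℤ) := by exact_mod_cast (pow_succ 2 k).symm
      rw [← mul_zsmul, hc, hP]
    have hrel₁ : a₁ • ((2 : ℤ) • P) + b₁ • (c₀ • ((2 : ℤ) • P)) = 0 := by
      rw [smul_zsmul_geomPoints, ← mul_zsmul, ← mul_zsmul, mul_comm a₁, mul_comm b₁]
      exact hrel
    obtain ⟨ha, hb⟩ := ih ((2 : ℤ) • P) hP₁ a₁ b₁ hrel₁
    refine ⟨?_, ?_⟩
    · have : ((2 ^ (k + 1 + 1) : ℕ) : ℤ) = 2 * ((2 ^ (k + 1) : ℕ) : ℤ) := by push_cast; ring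
      rw [this]
      exact mul_dvd_mul_left 2 ha
    · have : ((2 ^ (k + 1 + 1) : ℕ) : ℤ) = 2 * ((2 ^ (k + 1) : ℕ) : ℤ) := by push_cast; ring
      rw [this]
      exact mul_dvd_mul_left 2 hb

/-- **Item Q1 `CyclicTorsionOfNegDisc` (stmt-BirchSwinnertonDyer-24879) — PROVED.** For elliptic `W/ℚ` with `Δ < 0`, a complex
conjugation `c₀` and any `M`, some `P ∈ E[2^M]` satisfies `E[2^M] = {a·P + b·c₀P}`: `M = 0` is trivial (`E[1] = 0`); for
`M = k + 1` take `v ∈ E[2]` moved by `c₀` (`exists_twoTorsion_smul_ne_of_Δ_neg`), lift it to `P` with `2^k P = v`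
(`zsmul_geomPoints_surjective_holds`), and count: `(a, b) ↦ a·P + b·c₀P` is injective on `(ℤ/2^M)²` (`pow_dvd_of_rel`) and
`#E[2^M] = 4^M` (`card_torsionPoints_eq_sq_holds`), so it is onto. [cite: SilvermanAEC2009, Cor. III.6.4(b) and Prop. III.4.2(a)]
[cite: GrossLMS1991, §4] -/
theorem cyclicTorsionOfNegDisc_proof :
    Summit.BirchSwinnertonDyer.BirchSwinnertonDyer.Theses.GenusKolyvaginAtTwo.CyclicTorsionOfNegDisc := by
  intro W _ hΔ c₀ hc₀ M
  cases M with
  | zero =>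
    refine ⟨0, fun Q ↦ ⟨0, 0, ?_⟩⟩
    obtain ⟨Q₀, hQ₀⟩ := Q
    have h : ((2 ^ 0 : ℕ) : ℤ) • Q₀ = 0 := (mem_geomTorsion_iff W _ Q₀).mp hQ₀
    rw [pow_zero, Nat.cast_one, one_zsmul] at h
    subst h
    apply Subtype.ext
    simp
  | succ k =>
    -- a `2`-torsion point moved by `c₀`
    obtain ⟨v, hv⟩ := KolyvaginEigenTwo.exists_twoTorsion_smul_ne_of_Δ_neg W hΔ hc₀
    have hv2 : (2 : ℤ) • (v : geomPoints W) = 0 := (mem_geomTorsion_iff W 2 (v : geomPoints W)).mp v.2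
    have hcv : c₀ • (v : geomPoints W) ≠ v := fun h ↦ hv (Subtype.ext h)
    -- lift it: `2^k · P₀ = v`, so `P₀ ∈ E[2^(k+1)]`
    obtain ⟨P₀, hP₀⟩ := W.zsmul_geomPoints_surjective_holds (n := ((2 ^ k : ℕ) : ℤ))
      (by exact_mod_cast pow_ne_zero k two_ne_zero) (v : geomPoints W)
    simp only at hP₀
    set N : ℕ := 2 ^ (k + 1) with hN
    have hN2 : ((N : ℕ) : ℤ) = 2 * ((2 ^ k : ℕ) : ℤ) := by rw [hN]; push_cast; ring
    have hmem : ∀ {Q : geomPoints W}, ((2 ^ k : ℕ) : ℤ) • Q = v ∨ ((2 ^ k : ℕ) : ℤ) • Q = c₀ • (v : geomPoints W) →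
        Q ∈ geomTorsion W (N : ℤ) := by
      intro Q hQ
      rw [mem_geomTorsion_iff, hN2, mul_zsmul]
      rcases hQ with h | h
      · rw [h, hv2]
      · rw [h, ← smul_zsmul_geomPoints, hv2, smul_zero]
    have hP₀mem : P₀ ∈ geomTorsion W (N : ℤ) := hmem (Or.inl hP₀)
    have hcP₀ : ((2 ^ k : ℕ) : ℤ) • (c₀ • P₀) = c₀ • (v : geomPoints W) := by
      rw [← smul_zsmul_geomPoints, hP₀]
    refine ⟨⟨P₀, hP₀mem⟩, ?_⟩
    -- the counting map
    haveI : NeZero N := ⟨pow_ne_zero _ two_ne_zero⟩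
    have hlin : ∀ a b : ℤ, a • P₀ + b • (c₀ • P₀) ∈ geomTorsion W (N : ℤ) := fun a b ↦
      add_mem (AddSubgroup.zsmul_mem _ hP₀mem a) (AddSubgroup.zsmul_mem _ (hmem (Or.inr hcP₀)) b)
    let g : ZMod N × ZMod N → geomTorsion W (N : ℤ) := fun ab ↦
      ⟨(ab.1.val : ℤ) • P₀ + (ab.2.val : ℤ) • (c₀ • P₀), hlin _ _⟩
    have hinj : Function.Injective g := by
      rintro ⟨a, b⟩ ⟨a', b'⟩ h
      have h' : ((a.val : ℤ) - a'.val) • P₀ + ((b.val : ℤ) - b'.val) • (c₀ • P₀) = 0 := by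
        have h0 := congrArg (fun Q : geomTorsion W (N : ℤ) ↦ (Q : geomPoints W)) h
        simp only [g] at h0
        rw [sub_zsmul, sub_zsmul, ← sub_eq_zero.mpr h0]
        abel
      obtain ⟨ha, hb⟩ := pow_dvd_of_rel c₀ hv2 hcv k P₀ hP₀ _ _ h'
      have hmod : ∀ {x y : ZMod N}, ((N : ℕ) : ℤ) ∣ (x.val : ℤ) - y.val → x = y := by
        intro x y hxy
        apply ZMod.val_injective N
        exact ((Nat.modEq_iff_dvd.mpr hxy).eq_of_lt_of_lt (ZMod.val_lt y) (ZMod.val_lt x)).symm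
      exact Prod.ext (hmod ha) (hmod hb)
    have hcardT : Nat.card (geomTorsion W (N : ℤ)) = N ^ 2 :=
      card_torsionPoints_eq_sq_holds W (AlgebraicClosure ℚ) (n := N) (by exact_mod_cast (NeZero.ne N))
    haveI : Finite (geomTorsion W (N : ℤ)) := Nat.finite_of_card_ne_zero (by rw [hcardT]; positivity)
    have hle : Nat.card (geomTorsion W (N : ℤ)) ≤ Nat.card (ZMod N × ZMod N) := by
      rw [hcardT, Nat.card_prod, Nat.card_zmod, sq]
    have hbij : Function.Bijective g := hinj.bijective_of_nat_card_le hle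
    intro Q
    obtain ⟨⟨a, b⟩, hab⟩ := hbij.2 Q
    refine ⟨(a.val : ℤ), (b.val : ℤ), ?_⟩
    apply Subtype.ext
    rw [← hab]
    simp only [g, AddSubgroup.coe_add, AddSubgroupClass.coe_zsmul]
    rfl

end Summit.BirchSwinnertonDyer.BirchSwinnertonDyer.Theorems.GenusCyclicTorsion

end
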